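import Mathlib
import HarnessLib
import HarnessLib.Audit
import Summits.AtomisticToContinuum.Statement
import Literature.Dynamics.Hyperbolic.AnosovDie
import Literature.MathematicalPhysics.KineticTheory.InfiniteRotorGas
import Summits.AtomisticToContinuum.HydrodynamicLimit.Theorems.TwoClocksEntropyToHydro
import HarnessLib.Audit.Status.Attr

/-!
Route: AnosovDiceHopf

DORMANT since 2026-08-24T16:41:41Z (reconciler: no traction for 6.9 d (last activity item-evidence-added at 2026-08-17T18:24:17Z); parked, not closed — `ledger route dormant route-AtomisticToContinuum-AnosovDiceHopf --off` to reactivate) — unstaffed, not closed; items shared with open routes are served there. `ledger route dormant <id> --off` reactivates.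

# Route AnosovDiceHopf — OVY's noise step from a one-sphere Hopf property — Anosov-rotor dice
calibrate it (typed), specular dice decide it

It suffices to show X = X_G ∧ X_T ∧ X_OVY. X_G (OVYLimitsAreGibbs, typed, rank 2): every OVY limit
state of the TRUE
hard-sphere gas (vague space-time limit of the blown-up evolved local-Gibbs laws, `IsOVYLimitState`)
that is a regular
stationary state of an infinite hard-sphere flow, has no vacuum atom and has all translation-ergodic
components dilute
(a.s. local density ≤ η₀) is a mixture of hard-sphere Gibbs states — OllaVaradhanYau1993's missing
"strong ergodic theorem"
(§1 p. 525, §4 (B)–(D)) posed exactly on the states the relative-entropy method produces, the only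
place it uses noise.
X_T (EnergyCurrentTails, typed, shared): cubic velocity tails are uniformly integrable pre-shock.
X_OVY (OVYRemainderInBand, typed
CRUX since the 2026-08-16 crux-only repair — it is load-bearing and hides the hard-core-specific
risks: contact currents,
the bad-block step): the deterministic rest of OVY for hard cores IN THE PACKING BAND (limit points
ARE such states at small σ,
two-block/LD, virial EOS, contact currents, Gronwall) turning X_G ∧ X_T into the GUARDED Yau target
RelEntropyVanishingInBand (the entropy routes' shared target stmt-0766 with the conjunct's packing
guard
`∀ t < T ∀ x, ρ_t(x)σ³ < η₀` inserted after the Euler solution, ∃ η₀ outermost — the 2026-08-16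
re-typing of the conjunct,
p126922, threaded through the route's frame), whence the conjunct by the entropy inequality in band,
PROVED INSIDE `closes` from the landed step `Theorems.tendstoHydroFieldsAt_of_klDiv` (the assembly
item
EntropyMethodTransferInBand records that step and is no longer assumed). Card realised:
anosov-rotor-spheres. Its mechanism
is HOW X_G is to be proved and where it is first provable: X_G ⇐ SpecularDiceHopf (rank 4, informal:
OVY limit states of the
specular gas have the ONE-SPHERE HOPF PROPERTY (H) — the conditional law of a sphere's next outgoing
direction given
everything but its own velocity direction is absolutely continuous) → OneSphereHopfToMaxwellian
(rank 5, informal: the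
MACHINE, (H) + stationarity ⇒ Gibbs mixture, for every die including the trivial one); and the
CALIBRATION THEOREM
RotorGasMacroErgodic (rank 3, TYPED over the definitions AnosovDie / DicedHardSphereFlow /
RotorGas.InfiniteDicedFlow that
landed today): for the deterministic, reversible, Liouville ⊗ m-preserving rotor gas HS_rot(Ω, D) —
hard spheres whose
outgoing Lambert point is F(θ_i, θ_j)(p) with θ_i internal Anosov rotors of microscopic speed Ω —
dilute regular
stationary OVY limit states are Gibbs ⊗ m mixtures once Ω ≥ Ω₀(data); with RotorGasEulerLimit (typed
support) this is the
first fixed-density compressible-Euler theorem for a deterministic reversible gas, and it tells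
SpecularDiceHopf exactly
how much uniform hyperbolicity the true gas must supply. This is the conforming re-open (D-0027
§2.1) of route
AnosovRotorDice, retired 13:38Z only because its assembly named the Literature alias: here,
crux-only,
`closes : OVYLimitsAreGibbs → EnergyCurrentTails → OVYRemainderInBand → _root_.HydrodynamicLimit`
(three CRUX binders, proved
sorry-free with the entropy transfer inline).
Lean: `OVYLimitsAreGibbs ∧ EnergyCurrentTails ∧ OVYRemainderInBand`

## Assembly
CRUX-ONLY DECIDING THEOREM (route-repair 2026-08-16, gate flag glue.non-crux-hypothesis on
OVYRemainderInBand /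
EntropyMethodTransferInBand): glue.lean `theorem closes (h₂ : OVYLimitsAreGibbs) (h₆ :
EnergyCurrentTails)
(h₈ : OVYRemainderInBand) : _root_.HydrodynamicLimit` — every binder a CRUX (OVYRemainderInBand
re-badged crux), nothing else
assumed. Proof (10 lines, Sketch.lean rc 0, axioms propext/Classical.choice/Quot.sound): `h₈ h₂ h₆ :
RelEntropyVanishingInBand`
gives η₀ and, per profiles, σ₀; for σ < σ₀, a guarded classical solution, Φ, convergence at t = 0
and t < T obtain
⟨a_t, probability, exponential concentration, klDiv/(N+1) → 0⟩ and apply the landed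
entropy-inequality step
`Summit.AtomisticToContinuum.HydrodynamicLimit.Theorems.tendstoHydroFieldsAt_of_klDiv`
(Theorems/TwoClocksEntropyToHydro.lean,
now imported by the route file) — the SAME η₀ and σ₀, the guard threaded through unchanged. The
assembly item
EntropyMethodTransferInBand (stmt-17397, `RelEntropyVanishingInBand → _root_.HydrodynamicLimit`)
stays as the route's
assembly RECORD — provable verbatim by the same five lines (planner Sketch.lean
`entropyMethodTransferInBand_proof`, rc 0), no
longer a binder of `closes` (the gate does not drop assembly items); the target
RelEntropyVanishingInBand is DERIVED inside
`closes`, not assumed.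
STATEMENT RE-TYPE REPAIR 2026-08-16 (p126922: the conjunct is now the packing-guarded limit, ∃ η₀
outermost, guard
ρ_t(x)σ³ < η₀ on [0,T) × 𝕋³): the unguarded frame items RelEntropyVanishing (0766), OVYRemainder
(14286),
EntropyMethodTransfer (9240), MaxwellianOneBody (14290), MaxwellianOfEntropy (14291) were restated
1:1 in THIS route by their in-band forms (the shared ones keep their other routes; the old texts
stay as records), each
implied by the item it replaces (EntropyMethodTransferInBand since inlined into `closes`, kept as
the assembly record);
RotorGasEulerLimit was restated 1:1 with the same guard; OVYLimitsAreGibbs, RotorGasMacroErgodic,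
EnergyCurrentTails (shared
9235, kept unguarded), the dice items and the two informal cruxes are untouched. Upstream of
OVYLimitsAreGibbs the card's
mechanism is the foreseen glued split SpecularDiceHopf → OneSphereHopfToMaxwellian →
OVYLimitsAreGibbs (informal until
definition request D4 lands); the calibration chain RotorGasMacroErgodic (+ DiceConstructionAE,
DicedDynamicsExist) ⇒
RotorGasEulerLimit is parallel and not a hypothesis of `closes` (DiceConstruction, stmt-14288, was
refuted-misstated
2026-08-15 and replaced by DiceConstructionAE; the calibration items were restated over a.e.
pair-plaque submersivity +
swap-equivariance).

Rationale: WHY THIS LINE. OllaVaradhanYau1993 (§4 (B)), FritzFunakiLebowitz1994 (§1.1) and LiveraniOlla1996 use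
conservative noise for one thing — its
Dirichlet form vanishes on a regular stationary state, so the conditional velocity law is invariant
under pair re-scattering, hence
Maxwellian; BoltzmannHypothesisBarrier records that nothing replaces this deterministically. The
card replaces the Dirichlet form by a HOPF
ARGUMENT read one sphere at a time: if each sphere's scattering outcome is a submersive function of
a coordinate along which the state is
absolutely continuous (an unstable plaque), invariance spreads absolute continuity over the pair
shells — smooth ergodic theory of skew
products over Anosov systems (BrinPesin1974, LedrappierYoung1985, BurnsWilkinson2010; stable
ergodicity of compact-group and skew extensions
doi:10.1016/s0040-9383(98)00008-1, doi:10.1016/s0012-9593(00)87721-6,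
doi:10.1016/s0040-9383(98)00064-0; Anosov-fibre limit theorems
Dolgopyat2005, DolgopyatLiverani2011, DesimoiLiverani2018, CanestrariLiveraniOlla2026) imported into
Yau's relative-entropy architecture at
HYPERBOLIC scaling with O(1) collisional coupling, where CanestrariLiveraniOlla2026 is diffusive and
weakly coupled. Putting the uniform
hyperbolicity INSIDE each molecule (HS_rot) makes every estimate a
one-sphere-against-frozen-environment estimate with no N-dependence — which
UGibbsSRBRigidity's u-regular limits (N-body unstable wavefronts), PesinPricing's volume lemma and
JeansLoadedDice's INTEGRABLE internal clock do
not have — and the typed vocabulary files the deterministic one-block input (OVYLimitsAreGibbs) and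
its rotor calibration as Lean statements.
Negatives index: one statement of this line refuted — DiceConstruction (stmt-14288,
refuted-MISSTATED 2026-08-15: submersivity at EVERY
point of the disc is impossible for any Anosov die; kept as the negative edge, replaced by
DiceConstructionAE); the other 16 refutations on
file touch no item here. STATEMENT RE-TYPE 2026-08-16 (p126922): the conjunct is now PACKING-GUARDED
(∃ η₀ outermost; guard ρ_t(x)σ³ < η₀ on
[0,T) × 𝕋³) and the route's frame carries the same guard — spine OVYLimitsAreGibbs →
EnergyCurrentTails → OVYRemainderInBand →
EntropyMethodTransferInBand: the unguarded Yau target 0766 put ∃σ₀ before ∀T ∀solution and so asked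
the local Gibbs reference to follow an
imploding Euler solution beyond close packing, which OVY's step (A) and the inverse-EOS choice of
a_t cannot do and which is refutable by
statics alone once ImplosionDichotomy's DenseExcursion (stmt-12586) lands; the guard is exactly the
hypothesis under which OVYRemainder's
programme runs, so it is consumed there and nowhere else.

RANKED CRUXES. #0 RelEntropyVanishingInBand (target) — Yau's entropy form of the GUARDED limit (the
entropy routes' shared target stmt-0766 with the conjunct's packing guard inserted after the Euler
solution, ∃ η₀ outermost; verbatim the hypothesis of the landed dock
Theorems.hydroLimitInBand_of_relEntropyVanishingInBand; implied by 0766): ∃ η₀ > 0 ∀ continuous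
profiles ∃ σ₀ ∀ σ < σ₀ ∀ classical hs-Euler solutions on [0,T) with ρ_t(x)σ³ < η₀ ∀ flows, the local
Gibbs laws are probability measures and, if their fields converge at t = 0, then ∀ t < T some
activity profile a_t makes the reference local Gibbs law (a_t, u_t, θ_t) concentrate the three
fields exponentially around (ρ, ρu, E)(t) with klDiv(law_t ‖ reference)/(N+1) → 0. (why it might
fail: in substance the guarded conjunct — deterministic spheres at fixed σ may not keep local
equilibrium on Euler times even in the dilute band; known only with noise, OllaVaradhanYau1993 Thm
2.1; dies with any refutation of MaxwellianOneBodyInBand.) [Yau1991, OllaVaradhanYau1993, Spohn1991]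
#1 EntropyMethodTransferInBand (assembly RECORD, no longer a binder of `closes` since the 2026-08-16
crux-only repair) — the entropy transfer RelEntropyVanishingInBand → _root_.HydrodynamicLimit with
the same η₀, σ₀ (entropy inequality for events, exponential concentration of the reference, transfer
along the measurable flow; KipnisLandim1999 A1.8.2 / Yau1991 §2), PROVED INSIDE the crux-only
`closes` from the landed `Theorems.tendstoHydroFieldsAt_of_klDiv`
(Theorems/TwoClocksEntropyToHydro.lean, imported by the route file) and provable as an item verbatim
by the same five lines (planner Sketch.lean `entropyMethodTransferInBand_proof`, rc 0) — an idle
plain prover may land it; nothing waits on it. [difficulty: S] [KipnisLandim1999, Yau1991]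
#2 OVYLimitsAreGibbs (crux) — THE DETERMINISTIC ONE-BLOCK INPUT (OVY's strong ergodic theorem posed
on the states the method produces; conclusion of SpecularDiceHopf + OneSphereHopfToMaxwellian for
the trivial die): ∃ η₀ > 0 such that for every σ, T₀ > 0, continuous positive profiles, all torus
hard-sphere flows Φ_N, every infinite hard-sphere flow Φ (diameter 1) and every law μ on
configurations: if μ is an OVY limit state (vague cluster point of the space-time averaged blown-up
laws Q^(ε_N)), a regular stationary state of Φ, vacuum-free (μ{∅} = 0) and componentwise dilute
(μ-a.s. eventually #(ω ∩ [−(n+1),n+1)³) ≤ η₀ (2n+2)³), then μ is a mixture of hard-sphere Gibbs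
states. [difficulty: open-problem] (why it might fail: it is the Boltzmann hypothesis where OVY need
it — a dilute regular stationary OVY limit carrying an extensive hidden invariant
(velocity–configuration correlations in WHICH pairs collide) would be non-Gibbs; proved for no
deterministic interacting gas, false for d = 1 rods.) [OllaVaradhanYau1993, FritzFunakiLebowitz1994,
LiveraniOlla1996, Bernardin2014, Spohn1991,
Literature.Barriers.AtomisticToContinuum.BoltzmannHypothesisBarrier]
#3 RotorGasMacroErgodic (crux) — THE CALIBRATION THEOREM (card crux 1, typed over AnosovDie /
DicedHardSphereFlow / RotorGas.InfiniteDicedFlow; stmt-14022): for every Anosov die (compact rotor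
(K, m) with an ergodic, reversible, exponentially mixing flow, uniformly expanded unstable plaques
with a.c. transverse measure, area-preserving reversible die map F on the Lambert disc) with a.c.
die law, PAIR-PLAQUE SUBMERSIVE A.E. (m⊗m-a.e. (θ,θ′), Lebesgue-a.e. p — "every p" is impossible,
see DiceConstructionAE) and SWAP-EQUIVARIANT (F(θ′,θ) = R′∘F(θ,θ′)∘R′, R′ = diag(1,−1): the
condition under which the finite label-ordered and the infinite `Leads`-ordered collision rules
agree, refuter finding F1), ∃ η₀ > 0 such that for all σ, T₀ > 0 and continuous positive profiles
there is Ω₀ with: for every rotor speed Ω ≥ Ω₀ (torus speed Ω/ε_N), all torus diced flows Ψ_N, every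
infinite diced flow Φ (diameter 1, speed Ω) and every OVY limit state μ of the rotor gas from local
Gibbs ⊗ m^⊗ data that is a regular stationary state of Φ, vacuum-free and componentwise dilute (≤
η₀), μ is a Gibbs ⊗ m mixture. CALIBRATION crux: deliberately not a hypothesis of `closes`; its
refutation closes the route. [difficulty: XL] (why it might fail: rotor plaques are strong-unstable
for the coupled skew product only where Ω·rate beats the gas's local expansion, unbounded on
collision clusters; leafwise a.c. must survive the space-time-averaged vague limit, where entropy is
only u.s.c.; a.e.-p submersivity leaves a null bad set of incoming Lambert points, harmless only for
locally a.c. states.) [LedrappierYoung1985, BrinPesin1974, BurnsWilkinson2010,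
doi:10.1016/s0012-9593(00)87721-6, doi:10.1016/s0040-9383(98)00008-1, Dolgopyat2005,
DolgopyatLiverani2011, DesimoiLiverani2018, CanestrariLiveraniOlla2026, Liverani2004,
OllaVaradhanYau1993]
#6 EnergyCurrentTails (crux) — UNIFORM INTEGRABILITY OF THE CUBIC VELOCITY TAILS PRE-SHOCK (shared
stmt-9235 of eight routes, kept UNGUARDED: a statement about the microscopic dynamics, not refutable
by Euler statics): for continuous profiles ∃ σ₀ ∀ σ < σ₀ ∀ classical hs-Euler solutions on [0,T) ∀
flow families, if the local Gibbs fields converge at t = 0 then ∀ t < T ∀ ε > 0 ∃ M, N₀ ∀ N ≥ N₀ ∀ s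
∈ [0,t]: E[(N+1)⁻¹ Σ_i |v_i(s)|³ 1(|v_i(s)| > M)] ≤ ε. Tail input of BOTH OVY chains (true gas and
HS_rot). [difficulty: open-problem] (why it might fail: energy conservation bounds only quadratic
moments and entropy w.r.t. Gibbs sees nothing above |v|²; the dynamics could focus energy ≍ N^(2/3)
on O(1) spheres with non-negligible probability — no maximum principle for hard-sphere energy
cascades is known.) [NachtergaeleYau2003, OllaVaradhanYau1993,
Literature.Barriers.AtomisticToContinuum.HighMomentumCutoffBarrierNarrow, Spohn1991]
#9 OVYRemainderInBand (crux, re-badged support→crux 2026-08-16: it is a binder of the crux-only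
`closes` and it is NOT routine — see why it might fail) — THE DETERMINISTIC REST OF OVY FOR HARD
CORES, IN THE PACKING BAND (known method, NEW SETTING; replaces OVYRemainder 14286, whose unguarded
conclusion needed dilute control along arbitrary classical solutions): OVYLimitsAreGibbs →
EnergyCurrentTails → RelEntropyVanishingInBand, η₀ the prover's choice (≤ the cluster-expansion
radius). (why it might fail: uniform integrability of |v|³ pays OVY's truncation step but not the
printed bad-block/Gronwall step, whose constant δ⁻¹M needs a cut-off error o(e^{-CM}) —
HighMomentumCutoffBarrierNarrow caveat (c); the hard-core collisional-transfer currents are contact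
terms on ∂{|q_i − q_j| = σ} invisible to the fixed-time bound H(f_t | Gibbs) ≤ CN;
OllaVaradhanYau1993 treat smooth potentials only and step (A) without noise is unprinted.) Content:
(A) for σ < σ₀(profiles, η₀) every vague cluster point of Q^(ε_N) over the pre-shock window of a
GUARDED solution is a regular stationary state of an equilibrium infinite hard-sphere flow
(Alexander1976), vacuum-free, with components of density ≤ C η₀ (static large deviations for local
Gibbs references, entropy bound H(f_t | Gibbs) ≤ CN, OVY Lemmas 4.1/4.2/4.7 without noise);
one-block from OVYLimitsAreGibbs; two-block / exponential LLN for canonical local Gibbs states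
(cluster expansion, Ruelle1969); virial identification of the Gibbs expectation of the kinetic +
contact currents with hsPressure; tails from EnergyCurrentTails; relative-entropy Gronwall with
contact currents; a_t by the inverse low-density EOS (invertible in band). [difficulty: XL]
[OllaVaradhanYau1993, Yau1991, NachtergaeleYau2003, KipnisLandim1999, Alexander1976, Ruelle1969,
LebowitzPenrose1964, Literature.Barriers.AtomisticToContinuum.HighMomentumCutoffBarrierNarrow]
#9 RotorGasEulerLimit (support) — THE ANALOGUE THEOREM, GUARDED LIKE THE CONJUNCT (card crux 2;
restated 2026-08-16: `∃ η₀ > 0` after the die hypotheses, packing guard after the Euler solution,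
everything else verbatim; implied by the old 14023): for every Anosov die of the repaired class ∃ η₀
> 0 such that for all continuous positive profiles ∃ Ω₀ such that for Ω ≥ Ω₀ ∃ σ₀ with, for σ < σ₀,
every classical hs-Euler solution on [0,T) with ρ_t(x)σ³ < η₀ (the SAME IsHardSphereEulerSolution:
the die changes no statics) and all torus diced flows HS_rot(Ω/ε_N, D): if under the local Gibbs ⊗
m^⊗ laws the empirical fields of the translational configuration converge in probability at t = 0,
they converge for every t < T — if completed, the first deterministic, reversible,
fixed-positive-density compressible-Euler theorem (hyperbolic-scale counterpart of
CanestrariLiveraniOlla2026). Intended proof: RotorGasMacroErgodic + the diced copy of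
OVYRemainderInBand. [difficulty: XL] [OllaVaradhanYau1993, Yau1991, FritzFunakiLebowitz1994,
CanestrariLiveraniOlla2026]
#9 DiceConstructionAE (support) — THE CONSTRUCTION, REPAIRED (stmt-13994; replaces DiceConstruction
14288, refuted-misstated via AnosovDie.not_isPairPlaqueSubmersive — kept as the negative edge): an
Anosov die with a.c. die law, pair-plaque submersive for m⊗m-a.e. (θ,θ′) and Lebesgue-a.e. p (the
refuter's C′; {det(Y,Z) = 0} is always a curve, so a.e. is the most one can ask) and
swap-equivariant EXISTS. Intended instance (details in the item's docstring): K = T¹M of a closed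
hyperbolic surface with the geodesic flow and horocycle plaques (exponential mixing Liverani2004 /
Moore), die = time-one map of a disc Hamiltonian χ(|p|²)(b(x)·p − b(x′)·(R′p)) with χ, b
real-analytic (swap-equivariance since R′ is anti-symplectic; a.c. law by analyticity + Sard; a.e.
submersivity since det(Y,Z) ≢ 0 is real-analytic). L if the two rotor facts are vendored, else XL.
[difficulty: XL] [Liverani2004, BrinPesin1974, BurnsWilkinson2010, Dolgopyat2005, FeresZhang2012]
#9 DicedDynamicsExist (support) — NON-VACUITY OF THE FLOW HYPOTHESES of items 3/9: for every Anosov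
die, (i) torus diced hard-sphere flows exist for 0 < ε < 1/2, all N, Ω (Alexander1975's measure
argument: the diced collision map is a smooth flux-preserving bijection off grazing); (ii) for every
Ω an infinite diced equilibrium flow of diameter 1 exists (Alexander1976 Thm 5.2 for marked spheres
with autonomous rotors). [difficulty: L] [Alexander1975, Alexander1976, GST2013,
DobrushinSinaiSukhov1989]
#9 MaxwellianOneBodyInBand (support) — ONE-BODY LOCAL-MAXWELLIAN LLN, IN THE PACKING BAND (finite-N
observable content of step (B); stmt-4742/14290 with the conjunct's guard, ∃ η₀ outermost —
unguarded it asked configurations to match over-packed densities along imploding solutions): same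
frame as the re-typed conjunct; for every t < T, bounded continuous ψ on 𝕋³ × ℝ³ and δ > 0, P_N(|∫ψ
d(empirical measure of Φ_N,t z) − ∫ρ_t(x)∫ψ(x,v) M_(1,u_t(x),θ_t(x))(v) dv dx| > δ) → 0 under the
initial local Gibbs law. Necessary for the target (MaxwellianOfEntropyInBand), refutable at finite N
(false for free flight), not implied by the conjunct. [difficulty: open-problem]
[OllaVaradhanYau1993, Spohn1991, FritzFunakiLebowitz1994,
Literature.Barriers.AtomisticToContinuum.BoltzmannHypothesisBarrierNarrow]
#9 MaxwellianOfEntropyInBand (support) — the waypoint is NECESSARY for the guarded target, provable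
now (same η₀, σ₀): entropy inequality μ(A) ≤ (log 2 + H(μ|λ))/log(1 + 1/λ(A)) (KipnisLandim1999
A1.8.2, proved in tree) plus an exponential LLN for N⁻¹Σψ(x_k,v_k) under the reference local Gibbs
law (Hoeffding over the conditionally independent Maxwellian velocities around N⁻¹Σg(x_k), g = ∫ψ M
dv, then the density clause with χ = g). Makes ¬MaxwellianOneBodyInBand refute
RelEntropyVanishingInBand — and the entropy routes' unguarded 0766, which implies it — mechanically.
[difficulty: M] [Yau1991, OllaVaradhanYau1993, KipnisLandim1999]

TWO-LAYER PLAN. (a) OVYLimitsAreGibbs ⇐ SpecularDiceHopf → OneSphereHopfToMaxwellian →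
OVYLimitsAreGibbs once D4 (next-collision outcome /
property (H)) lands and the two informal cruxes are typed by set-signature (ranks 4–5). (b)
RotorGasMacroErgodic ⇐ RotorDomination
(strong-unstable leaves of the coupled skew product are Hölder graphs over the pair plaques W^u(θ_i)
× W^u(θ_j) off a small set,
tempered distortion) → RotorURegularLimit (rotor-u-regularity of local Gibbs ⊗
m^⊗ data propagates along HS_rot and to the space-time-averaged vague limits; then (H) through the
a.e. pair-plaque submersion) → RotorGasMacroErgodic. (c) OVYRemainderInBand ⇐
LimitPointsRegularInBand (OVY (A) deterministic, for
guarded solutions: cluster points are regular stationary, vacuum-free, componentwise dilute ≤ C η₀)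
→ GronwallFromGibbsInBand → OVYRemainderInBand.

KILL CRITERIA. (1) ¬RotorGasMacroErgodic — an HS_rot(Ω, D) with an a.c., a.e.-submersive,
swap-equivariant die admitting, for all large Ω, a dilute regular stationary
OVY limit state that is not a Gibbs ⊗ m mixture — kills the machine on its easiest instance: close
`refuted:RotorGasMacroErgodic` (the specular gas is
strictly harder) and retire every "dice" card with it. (2) ¬OVYLimitsAreGibbs (a non-Gibbs
dilute regular stationary OVY limit of the true gas) closes the route outright and breaks
UGibbsSRBRigidity / PesinPricing /
BGEndpointRigidity at their informal rigidity nodes. (3) ¬EnergyCurrentTails closes every entropy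
route including this one.
(4) ¬MaxwellianOneBodyInBand refutes RelEntropyVanishingInBand through MaxwellianOfEntropyInBand,
and with it the entropy routes' shared
unguarded target 0766 (0766 ⇒ RelEntropyVanishingInBand) — close. NOT a kill: a DenseExcursion-type
implosion witness (ImplosionDichotomy) —
it refutes only the unguarded 0766/14290, which this route no longer wants.
Mooted, not killed: OVYLimitsAreGibbs proved elsewhere (any rigidity route) leaves only
OVYRemainderInBand + tails here; a proof of
RelEntropyErgodic-style GibbsErgodicity for ALL regular states supersedes crux 2.

NOT DECOMPOSED YET. The one-sphere Hopf property (H) and the next-collision outcome map (definition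
request D4) — so SpecularDiceHopf and
OneSphereHopfToMaxwellian stay informal items; OVY's deterministic step (A) (limit points of GUARDED
evolutions are regular stationary states of
an equilibrium Alexander flow, vacuum-free, componentwise dilute ≤ C η₀) kept inside
OVYRemainderInBand, the only consumer of the packing guard
(η₀ = the prover's choice, at most the virial/cluster-expansion radius); the Ω₀(data) dependence
(domination threshold ≍ thermal speed ×
log(mean free path)/mean free path in blown-up units) and η₀(D); grazing / collision-sequence-change
measure estimates for the rotor
holonomies; time reversibility of HS_rot (holds, unused); the Ω → ∞ sanity limit (i.i.d. dice) and
the fact that fixed torus speed gives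
FROZEN rotors (a quenched deterministic rule, NOT the conjunct — hence torus speed Ω/ε_N in the
items). Collision-orientation convention
(refuter finding F1, evidence ConventionMismatch.lean): finite flows collide label-ordered pairs,
infinite flows `Leads`-ordered ones; handled
by the swap-equivariance hypothesis of items 3/9 — a Literature-level alternative (orient
`IsDicedHardSphereTrajectory.binary` by `Leads`)
would remove it. A.s. collision recurrence (`CollidesInfinitelyOften`, finding F2) is no item's
hypothesis: it is derived inside the proofs
of OVYLimitsAreGibbs / RotorGasMacroErgodic from regular + stationary + no vacuum atom + dilute
(helpers ride with --supports).

CHEAPEST FALSIFIER. (i) TWO-ROTOR READABILITY ALGEBRA — partly answered 2026-08-15 by the refutation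
of DiceConstruction
(AnosovDie.not_isPairPlaqueSubmersive: (r, r′) ↦ F(W θ r, W θ′ r′)(p) is never a submersion at (0,0)
for ALL |p| < 1, and {det(Y,Z) = 0}
is a curve for every (θ, θ′); the items now ask a.e. p). Still open, still cheapest
(finite-dimensional, by hand/CAS): does iterating
collisions of ONE tagged rotor sphere against a FROZEN dilute environment spread absolute continuity
from the disc to its whole velocity law
(transitivity of the generated re-scattering moves on pair shells), the incoming Lambert point
avoiding a null set (automatic for locally
a.c. states)? If no smooth swap-equivariant die does this, RotorGasMacroErgodic dies cheaply. (ii)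
VACUITY probes: `μ {∅} = 0` + the a.s. count bound do not exclude genuine OVY limits of positive
continuous data (density ≥ an
inf a₀-dependent bound); the guarded frame items are not junk-true for any η₀ (the ∀-body over
guarded constant solutions remains, cf.
the re-type probes hydro_p3). (iii) Numerics (kit): event-driven MD of HS_rot with a cat-map rotor
at packing 0.05 — kinetic-stress
isotropisation and tagged-velocity decorrelation vs Ω.

NUMBERS. Fixed reduced density (N+1)ε_N³ = σ³; ≍ (N+1)^(1/3) collisions per sphere per macroscopic
unit time, so the rotor runs at torus speed
Ω/ε_N to turn O(1) per mean free time (items 3, 9). Blown-up units (diameter 1, thermal speed ≍ √θ):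
mean free path ℓ ≈ 1/(√2·π·n) at number
density n (≈ 4.5 at n = 0.05, ≈ 22.5 at n = 0.01); per-collision expansion factor ≍ ℓ, i.e. Lyapunov
RATE ≍ √θ log ℓ/ℓ ≈ 0.33√θ (n = 0.05),
0.14√θ (n = 0.01): domination asks Ω·rate ≳ this, failing only on collision clusters. dim T¹M = 3,
horocycle leaves 1-dimensional: one rotor
reads a CURVE in the 2-disc, the colliding PAIR an open set off a degeneracy curve. OVY's noise has
intensity θ(ε) → ∞, εθ(ε) → 0; here Ω ≥ Ω₀ is fixed. Items: 13 active (11 typed + 2 informal) ≤ 15,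
unchanged by the 2026-08-16 crux-only repair (OVYRemainderInBand re-badged crux;
EntropyMethodTransferInBand kept as the assembly record, inlined into `closes`): cruxes by kind
OVYLimitsAreGibbs r2, RotorGasMacroErgodic r3, SpecularDiceHopf r4 (informal), EnergyCurrentTails
r6, OVYRemainderInBand r9, plus the informal [crux]-intent support OneSphereHopfToMaxwellian r5 —
the 2026-08-15
repair and the 2026-08-16 re-type repair changed no count (0766/14286/9240/14290/14291 restated 1:1
here as the five in-band decls, shared ones keeping their other routes;
RotorGasEulerLimit restated under its name); `closes` is crux-only: OVYLimitsAreGibbs →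
EnergyCurrentTails → OVYRemainderInBand → _root_.HydrodynamicLimit, the entropy transfer proved
inline.

DEFINITION REQUESTS. D4 `OneSphereHopfProperty` (Literature/MathematicalPhysics/KineticTheory, on
top of InfiniteRotorGas.lean): the NEXT-COLLISION
OUTCOME of a particle p of ω ∈ Φ.good for an infinite (diced or undiced) flow Φ (first collision
time after 0, partner, contact normal,
outgoing Lambert point; measurable in (ω, p)) and the predicate HasOneSphereHopfProperty Φ μ: under
the Palm-type disintegration "typical
particle p, everything else", the conditional law of p's next outgoing Lambert point is a.c. w.r.t.
Lebesgue on the disc. Consumers: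
SpecularDiceHopf (F ≡ id), OneSphereHopfToMaxwellian (every RotorDie). Also wanted (tiny):
`AnosovDie.toRotorDie` (items 3/9 inline it as
`Dr = ⟨…⟩`) and a variant `IsOVYLimitStateMicro` taking the torus rotor speed Ω_N = Ω / hsDiameter σ
N (the items inline that clause).

Novelty: Searches (2026-08-15): `lit frontier AtomisticToContinuum --since 2021` (30 rows; the only
deterministic hydrodynamic-type limit
is CanestrariLiveraniOlla2026 = doi:10.1007/s00222-026-01429-1, diffusive, weak coupling); `lit
bridges AtomisticToContinuum
--cross any` (30 rows, none on internal-state gases); `lit search --source crossref` ×3 — "Anosov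
flow skew product hard sphere
gas hydrodynamic limit" (6 generic hits, none relevant), "stable ergodicity skew products compact
group extension Anosov Brin"
(Field–Parry 1999 doi:10.1016/s0040-9383(98)00008-1, Walkden 1999 doi:10.3934/dcds.1999.5.897,
Burns–Wilkinson 1999
doi:10.1016/s0012-9593(00)87721-6, Burns–Pugh–Wilkinson 2000 doi:10.1016/s0040-9383(98)00064-0,
Pollicott 2002
doi:10.3934/dcds.2002.8.599), "deterministic heat equation Anosov dynamics Liverani Olla" (CLO 2026,
Liverani–Olla ICMP 2010
doi:10.1142/9789814304634_0029, Liverani2004); `lit galaxy search --star all` ×3 ("Anosov internal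
degrees of freedom hard
spheres …" 0 rows; "compact group extensions" 12 generic rows; "random billiards" 11 rows, noise);
local `lit search --hybrid`
and arXiv unavailable (searchd down / HTTP 429), logged in NOTES.md; the card's two refuter audits
(novelty-audit-3-0, triage-4-0)
already searched crossref/frontier and their added prior art is adopted (Dolgopyat2005,
DolgopyatLiverani2011,
DesimoiLiverani2018, Melbourne–Stuart 2011, Kelly–Melbourne 2016/17, FeresZhang2012,
Chumley–Cook–Feres 2013, Eckmann–Young 2006,
rough spheres Cha  [refs: 10.1007/s00222-026-01429-1, 10.1016/s0040-9383(98, 10.3934/dcds.1999.5.897, 10.1016/s0012-9593(00, 10.3934/dcds.2002.8.599, 10.1142/9789814304634_0029, 2310.13338, doi:10.1007/s00222-026-01429-1, doi:10.1016/s0040-9383, doi:10.3934/dcds.1999.5.897, doi:10.1016/s0012-9593, doi:10.3934/dcds.2002.8.599, doi:10.1142/9789814304634_0029, CanestrariLiveraniOlla2026, Liverani2004, Dolgopyat2005, Dolgopyat]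

Barriers (technique_class: hopf-argument anosov-fibre u-gibbs-rigidity relative-entropy): - technique_class: hopf-argument anosov-fibre u-gibbs-rigidity relative-entropy
- Literature.Barriers.AtomisticToContinuum.BoltzmannHypothesisBarrier: MET HEAD-ON, as its scope
caveat (b) allows ("a proof of the needed input evades the barrier"): OVYLimitsAreGibbs IS the
classification input, posed only on OVY limit states, with the vacuum atom and non-dilute components
— the barrier's formal kernel is the ideal gas, whose stationary states (Haar ⊗ h)^⊗N have arbitrary
velocity law — excluded or harmless: at positive density with a.s. collisions the machine reads
absolute continuity only THROUGH collisions, and with no collisions nothing is claimed;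
RotorGasMacroErgodic proves the input for HS_rot, SpecularDiceHopf + OneSphereHopfToMaxwellian
attack it for the true gas, honestly labelled conjunct-hard.
- Literature.Barriers.AtomisticToContinuum.BoltzmannHypothesisBarrierNarrow: the flux-level kernel
(distinct stationary free-gas states with identical Euler currents; a rest-frame heat current) is
what MaxwellianOneBody + EnergyCurrentTails exclude for the interacting gas; this route supplies a
proof attempt of the classification on OVY limits, it does not assume it.
- Literature.Barriers.AtomisticToContinuum.MacroErgodicityBarrier: its evasion (a) "add conservative
noise" is replaced by "read a deterministic Anosov die at each contact" (HS_rot) and by the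
one-sphere Hopf property (true gas); Euler scaling, so no sector condition / fluctuation–dissipation
step arises.
- Literat

History (route lifecycle, newest last):
- 2026-08-15T20:53:26Z · rev 4: restated RotorGasMacroErgodic (stmt-AtomisticToContinuum-14285) — repair 1/3 (route-repair rfix, DiceConstruction stmt-14288 refuted-misstated by Theorems.AnosovDiceHopfDiceConstruction_refuted): RotorGasMacroErgodic (stmt-142 (planner-rfix-AtomisticToContinuum-AnosovDice-ca529dbc-0)
- 2026-08-15T20:54:17Z · rev 5: restated RotorGasEulerLimit (stmt-AtomisticToContinuum-14287) — repair 2/3 (route-repair rfix; DiceConstruction stmt-14288 refuted-misstated): RotorGasEulerLimit (stmt-14287, support) restated 1:1 over the same repaired die (planner-rfix-AtomisticToContinuum-AnosovDice-ca529dbc-0)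
- 2026-08-15T20:54:43Z · rev 6: restated DiceConstruction (stmt-AtomisticToContinuum-14288 refuted) — repair 3/3 (route-repair rfix): DiceConstruction (stmt-14288, support r9) refuted-MISSTATED by Summit.AtomisticToContinuum.HydrodynamicLimit.Theorems.AnosovDice (planner-rfix-AtomisticToContinuum-AnosovDice-ca529dbc-0)
- 2026-08-15T20:54:43Z · REPAIRED (restate DiceConstruction) — back to open: repair 3/3 (route-repair rfix): DiceConstruction (stmt-14288, support r9) refuted-MISSTATED by Summit.AtomisticToContinuum.HydrodynamicLimit.Theorems.AnosovDice (planner-rfix-AtomisticToContinuum-AnosovDice-ca529dbc-0)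
- 2026-08-15T20:58:20Z · rev 8: dropped RotorGasMacroErgodic, RotorGasEulerLimit — repair step 1/2 (route-repair after DiceConstruction stmt-14288 refuted-misstated): drop the never-refuted but VACUOUS calibration items RotorGasMacroErgodic (s (planner-rrefute-AtomisticToContinuum-AnosovDic-cc565df9-0)
- 2026-08-16T02:19:16Z · AUTO-CRUX: 1 conjecture-grade item(s) promoted to crux (SpecularDiceHopf) — refuter vetting / tiering apply (operator:999:1362873)
- 2026-08-16T23:23:30Z · rev 12: restated RelEntropyVanishing (stmt-AtomisticToContinuum-0766), MaxwellianOneBody (stmt-AtomisticToContinuum-14290), OVYRemainder (stmt-AtomisticToContinuum-14286), MaxwellianOfEntropy (stmt-AtomisticToContinuum-14291), EntropyMethodTransfer (stmt-AtomisticToContinuum-9240 proved), RotorGasEulerLimit (stmt-Atomi (planner-rrepair-AtomisticToContinuum-AnosovDic-3dbd269b-0)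
- 2026-08-24T16:41:41Z · DORMANT — reconciler: no traction for 6.9 d (last activity item-evidence-added at 2026-08-17T18:24:17Z); parked, not closed — `ledger route dormant route-AtomisticToConti (operator:999:668015)

sub-problem: HydrodynamicLimit · status: dormant · opened planner-plancard-AtomisticToContinuum-Hydrody-7cf9054b-g2-0 2026-08-15T19:07:16Z · rev 16 · ledger route-AtomisticToContinuum-AnosovDiceHopf
GENERATED by the gate from the ledger (D-0016/17). Provers cite these decls: `theorem foo : Summit.AtomisticToContinuum.HydrodynamicLimit.Theses.AnosovDiceHopf.<Decl> := …` in Summits/AtomisticToContinuum/HydrodynamicLimit/Theorems/<Name>.lean.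
-/

namespace Summit.AtomisticToContinuum.HydrodynamicLimit.Theses.AnosovDiceHopf

open scoped BigOperators Topology Manifold Classical MeasureTheory ProbabilityTheory Matrix InnerProductSpace ComplexConjugate ContinuousMap
open Filter Set Function TopologicalSpace MeasureTheory

attribute [summit_statement] _root_.HydrodynamicLimit

/-- item stmt-AtomisticToContinuum-17396 · target · rank 0 · open · by planner
why it might fail: In substance the guarded conjunct in entropy form: deterministic spheres at fixed σ may not keep local equilibrium on Euler times even in the dilute band — known only with OVY's noise (OllaVaradhanYau1993 Thm 2.1); via MaxwellianOfEntropyInBand any refutation of MaxwellianOneBodyInBand kills it.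
sources: Yau1991, OllaVaradhanYau1993, Spohn1991, KipnisLandim1999, Literature.Barriers.AtomisticToContinuum.BoltzmannHypothesisBarrierNarrow
[target] PACKING-GUARDED X_RE — the shared Yau-form target stmt-AtomisticToContinuum-0766 made to
match the RE-TYPED conjunct (Statement retype p126922, 2026-08-16: `_root_.HydrodynamicLimit` is now
the packing-guarded limit, ∃ η₀ outermost, guard ∀ t ∈ [0,T) ∀ x, ρ_t(x)σ³ < η₀ after the solution
hypothesis): there is η₀ > 0 (prover-chosen) such that for all continuous positive profiles ∃ σ₀ ∀
0<σ<σ₀ ∀ T ∀ classical hs-Euler solutions (ρ,u,θ) on [0,T) WHOSE LOCAL PACKING STAYS BELOW η₀ ∀ flow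
families Φ: the initial local Gibbs laws are probability measures and, if their empirical fields
converge at t = 0, then ∀ t < T ∃ activity profile a_t such that the reference local Gibbs law (a_t,
u_t, θ_t) is a probability measure whose density/momentum/energy fields concentrate exponentially (≤
C e^{-(N+1)/C}) around (ρ, ρu, E)(t) and klDiv(lawAt Φ_N (localGibbs a₀ u₀ θ₀) t ‖ localGibbs a_t
u_t θ_t)/(N+1) → 0. CANONICAL FORM: 0766 verbatim with the Statement's guard clause inserted at the
Statement's position and `∃ η₀ : ℝ, 0 < η₀ ∧` prefixed — sibling Yau-family routes re-targeting
after the retype should attach to THIS signature (dedup). 0766 ⇒ this (take η₀ := 1 and ignore the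
guard; Ske -/
@[route_item "route-AtomisticToContinuum-AnosovDiceHopf"]
def RelEntropyVanishingInBand : Prop :=
  ∃ η₀ : ℝ, 0 < η₀ ∧ ∀ (a₀ θ₀ : Literature.MathematicalPhysics.KineticTheory.T3 → ℝ) (u₀ : Literature.MathematicalPhysics.KineticTheory.T3 → Literature.MathematicalPhysics.KineticTheory.V3), Continuous a₀ → Continuous θ₀ → Continuous u₀ → (∀ x, 0 < a₀ x) → (∀ x, 0 < θ₀ x) → ∃ σ₀ : ℝ, 0 < σ₀ ∧ ∀ σ : ℝ, 0 < σ → σ < σ₀ → ∀ (T : ℝ) (ρ θ : ℝ → Literature.MathematicalPhysics.KineticTheory.T3 → ℝ) (u : ℝ → Literature.MathematicalPhysics.KineticTheory.T3 → Literature.MathematicalPhysics.KineticTheory.V3), Literature.MathematicalPhysics.KineticTheory.IsHardSphereEulerSolution σ T ρ u θ → (∀ t ∈ Set.Ico 0 T, ∀ x, ρ t x * σ ^ 3 < η₀) → ∀ Φ : (N : ℕ) → Literature.Analysis.FluidPDE.HardSphereFlow (Literature.Analysis.FluidPDE.Torus.geometry (Fin 3)) (Literature.MathematicalPhysics.KineticTheory.hsDiameter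 σ N) (N + 1), (∀ N, MeasureTheory.IsProbabilityMeasure (Literature.MathematicalPhysics.KineticTheory.localGibbsLaw σ a₀ u₀ θ₀ N (Φ N))) ∧ (Literature.MathematicalPhysics.KineticTheory.TendstoHydroFieldsAt (fun N => Literature.MathematicalPhysics.KineticTheory.localGibbsLaw σ a₀ u₀ θ₀ N (Φ N)) Φ ρ u θ 0 → ∀ t ∈ Set.Ico 0 T, ∃ a : Literature.MathematicalPhysics.KineticTheory.T3 → ℝ, (∀ N, MeasureTheory.IsProbabilityMeasure (Literature.MathematicalPhysics.KineticTheory.localGibbsLaw σ a (u t) (θ t) N (Φ N))) ∧ (∀ χ : Literature.MathematicalPhysics.KineticTheory.T3 → ℝ, Continuous χ → ∀ δ : ℝ, 0 < δ → ∃ C : ℝ, 0 < C ∧ ∀ N : ℕ, Literature.MathematicalPhysics.KineticTheory.localGibbsLaw σ a (u t) (θ t) N (Φ N) {z | δ < |Literature.MathematicalPhysics.KineticTheory.empiricalDensityField z χ - ∫ x, χ x * ρ t x|} ≤ ENNReal.ofReal (C * Real.exp (-(C⁻¹ * (N + 1)))) ∧ Literature.MathematicalPhysics.KineticTheory.localGibbsLaw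 σ a (u t) (θ t) N (Φ N) {z | δ < ‖Literature.MathematicalPhysics.KineticTheory.empiricalMomentumField z χ - ∫ x, (χ x * ρ t x) • u t x‖} ≤ ENNReal.ofReal (C * Real.exp (-(C⁻¹ * (N + 1)))) ∧ Literature.MathematicalPhysics.KineticTheory.localGibbsLaw σ a (u t) (θ t) N (Φ N) {z | δ < |Literature.MathematicalPhysics.KineticTheory.empiricalEnergyField z χ - ∫ x, χ x * Literature.MathematicalPhysics.KineticTheory.totalEnergyDensity (ρ t x) (u t x) (θ t x)|} ≤ ENNReal.ofReal (C * Real.exp (-(C⁻¹ * (N + 1))))) ∧ Filter.Tendsto (fun N : ℕ => InformationTheory.klDiv ((Φ N).lawAt (Literature.MathematicalPhysics.KineticTheory.localGibbsLaw σ a₀ u₀ θ₀ N (Φ N)) t) (Literature.MathematicalPhysics.KineticTheory.localGibbsLaw σ a (u t) (θ t) N (Φ N)) / ((N : ENNReal) + 1)) Filter.atTop (nhds 0))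

/-- item stmt-AtomisticToContinuum-14284 · crux · rank 2 · open · by planner
why it might fail: The Boltzmann hypothesis posed on OVY limits: a dilute entropy-regular stationary state of the infinite hard-sphere flow carrying an extra invariant (velocity-geometry correlations in which pairs collide) would be non-Gibbs; proved for no deterministic interacting gas in d>=2, false for d=1 rods.
sources: OllaVaradhanYau1993, Spohn1991, NachtergaeleYau2003, GurevichSuhov1976, GenoveseSimonella2012, FritzFunakiLebowitz1994
[crux] THE DETERMINISTIC ONE-BLOCK INPUT (OVY's strong ergodic theorem posed on the states the
method produces; conclusion of SpecularDiceHopf + OneSphereHopfToMaxwellian for the trivial die):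
there is η₀ > 0 such that for every σ, T₀ > 0, continuous positive profiles, every family of torus
hard-sphere flows Φ_N, every infinite hard-sphere flow Φ (diameter 1) and every law μ on
configurations of ℝ³ × ℝ³: if μ is an OVY limit state (vague cluster point of the space-time
averaged blown-up laws Q^(ε_N)), a regular stationary state of Φ (translation invariant, a.e.
defined, stationary, finite density and energy, entropy-regular), has no vacuum atom (μ{∅} = 0) and
is componentwise dilute (μ-a.s. eventually #(ω ∩ [−(n+1),n+1)³) ≤ η₀ (2n+2)³), then μ is a mixture
of hard-sphere Gibbs states g_(z,β,u). [difficulty: open-problem] -/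
@[route_item "route-AtomisticToContinuum-AnosovDiceHopf", crux]
def OVYLimitsAreGibbs : Prop :=
  ∃ η₀ : ENNReal, 0 < η₀ ∧ ∀ (σ T₀ : ℝ), 0 < σ → 0 < T₀ → ∀ (a₀ θ₀ : Literature.MathematicalPhysics.KineticTheory.T3 → ℝ) (u₀ : Literature.MathematicalPhysics.KineticTheory.T3 → Literature.MathematicalPhysics.KineticTheory.V3), Continuous a₀ → Continuous θ₀ → Continuous u₀ → (∀ x, 0 < a₀ x) → (∀ x, 0 < θ₀ x) → ∀ (ΦN : (N : ℕ) → Literature.Analysis.FluidPDE.HardSphereFlow (Literature.Analysis.FluidPDE.Torus.geometry (Fin 3)) (Literature.MathematicalPhysics.KineticTheory.hsDiameter σ N) (N + 1)) (Φ : Literature.Analysis.FluidPDE.InfiniteHardSphereFlow (Fin 3) 1) (μ : MeasureTheory.Measure (Literature.Analysis.FunctionSpaces.PointConfig (Literature.MathematicalPhysics.KineticTheory.V3 × Literature.MathematicalPhysics.KineticTheory.V3))), Literature.MathematicalPhysics.KineticTheory.IsOVYLimitState σ a₀ θ₀ u₀ T₀ ΦN μ → Literature.MathematicalPhysics.KineticTheory.RegularStationaryState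 Φ μ → μ {∅} = 0 → (∀ᵐ ω ∂μ, ∀ᶠ n : ℕ in Filter.atTop, ((Literature.Analysis.FunctionSpaces.PointConfig.count ω (Literature.MathematicalPhysics.KineticTheory.PointProcess.centredBox n ×ˢ (Set.univ : Set (Literature.MathematicalPhysics.KineticTheory.V3)))) : ENNReal) ≤ η₀ * MeasureTheory.volume (Literature.MathematicalPhysics.KineticTheory.PointProcess.centredBox (d := Fin 3) n)) → Literature.MathematicalPhysics.KineticTheory.IsHardSphereGibbsMixture 1 μ

-- earlier RotorGasMacroErgodic (stmt-AtomisticToContinuum-14285, replaced 2026-08-15T20:53:26Z -> stmt-AtomisticToContinuum-13990): retired by None — ∀ D : Literature.Dynamics.Hyperbolic.AnosovDie, D.HasAbsolutelyContinuousLaw → D.IsPairPlaqueSubmersive → ∀ Dr : Literature.Analysis.FluidPDE.RotorDie D.K, Dr = (Literature.Analysis.FluidPDE.RotorDie.mk D.m D.flow (fun θ θ' p => D.die θ θ' p) D.rev : L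
/-- item stmt-AtomisticToContinuum-14022 · crux · rank 3 · open · by planner
why it might fail: Domination is non-uniform: rotor plaques are strong-unstable only where Ω·rate beats the gas's local expansion, unbounded on collision clusters; leafwise a.c. must survive the space-time-averaged vague limit (entropy only u.s.c.); (H) ⇒ Gibbs and a.s. collision recurrence are unproved.
sources: BurnsWilkinson2010, LedrappierYoung1985, BrinPesin1974, Dolgopyat2005, DolgopyatLiverani2011, DesimoiLiverani2018
[crux] THE CALIBRATION THEOREM (card crux 1, steps (A)–(C), typed; 2026-08-15 route-repair of
stmt-14285, whose die hypothesis `AnosovDie.IsPairPlaqueSubmersive` is unsatisfiable (Literature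
`AnosovDie.not_isPairPlaqueSubmersive`), which made the old item vacuously true): for every Anosov
die D (interface `AnosovDie`: compact rotor (K, m) with an ergodic, reversible, exponentially mixing
measure-preserving flow, uniformly expanded unstable plaques with a.c. transverse measure, and an
area-preserving reversible die map F on the Lambert disc) whose die law is absolutely continuous,
which is PAIR-PLAQUE SUBMERSIVE ALMOST EVERYWHERE (for m⊗m-a.e. (θ,θ′) and Lebesgue-a.e. p in the
open Lambert disc the differential at 0 of (r,r′) ↦ F(W θ r, W θ′ r′)(p) is onto — the refuter's
repaired clause C′; "every p" is impossible because the divergence-free plaque-velocity field of r ↦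
F(W θ r, θ′)∘F(θ,θ′)⁻¹ has an interior zero) and SWAP-EQUIVARIANT (F(θ′,θ) = R′∘F(θ,θ′)∘R′ with R′ =
diag(1,−1): exactly the condition — refuter finding F1 on stmt-14285, evidence
ConventionMismatch.lean — under which the label-ordered pair rule of the finite flows
`DicedHardSphereFlow` (i < j) and the `Leads`-order -/
@[route_item "route-AtomisticToContinuum-AnosovDiceHopf"]
def RotorGasMacroErgodic : Prop :=
  ∀ D : Literature.Dynamics.Hyperbolic.AnosovDie, D.HasAbsolutelyContinuousLaw → (∀ᵐ q ∂(D.m.prod D.m), ∀ᵐ p ∂(MeasureTheory.volume.restrict (Metric.ball (0 : EuclideanSpace ℝ (Fin 2)) 1)), Function.Surjective (fderiv ℝ (D.pairPlaqueMap q.1 q.2 p) 0)) → (∀ (θ θ' : D.K) (p q : EuclideanSpace ℝ (Fin 2)), q 0 = p 0 → q 1 = -(p 1) → (D.die θ' θ p) 0 = (D.die θ θ' q) 0 ∧ (D.die θ' θ p) 1 = -((D.die θ θ' q) 1)) → ∀ Dr : Literature.Analysis.FluidPDE.RotorDie D.K, Dr = (Literature.Analysis.FluidPDE.RotorDie.mk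 D.m D.flow (fun θ θ' p => D.die θ θ' p) D.rev : Literature.Analysis.FluidPDE.RotorDie D.K) → ∃ η₀ : ENNReal, 0 < η₀ ∧ ∀ (σ T₀ : ℝ), 0 < σ → 0 < T₀ → ∀ (a₀ θ₀ : Literature.MathematicalPhysics.KineticTheory.T3 → ℝ) (u₀ : Literature.MathematicalPhysics.KineticTheory.T3 → Literature.MathematicalPhysics.KineticTheory.V3), Continuous a₀ → Continuous θ₀ → Continuous u₀ → (∀ x, 0 < a₀ x) → (∀ x, 0 < θ₀ x) → ∃ Ω₀ : ℝ, ∀ Ω : ℝ, Ω₀ ≤ Ω → ∀ (Ψ : (N : ℕ) → Literature.Analysis.FluidPDE.DicedHardSphereFlow (Literature.Analysis.FluidPDE.Torus.geometry (Fin 3)) (Literature.MathematicalPhysics.KineticTheory.hsDiameter σ N) (N + 1) Dr (Ω / Literature.MathematicalPhysics.KineticTheory.hsDiameter σ N)) (Φ : Literature.MathematicalPhysics.KineticTheory.RotorGas.InfiniteDicedFlow 1 Dr Ω) (μ : MeasureTheory.Measure (Literature.Analysis.FunctionSpaces.PointConfig (Literature.MathematicalPhysics.KineticTheory.RotorGas.Phase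 D.K))), (∃ κ : ℕ → ℕ, StrictMono κ ∧ ∀ f : Literature.MathematicalPhysics.KineticTheory.RotorGas.Phase D.K → ℝ, Continuous f → HasCompactSupport f → (∀ p, 0 ≤ f p) → Filter.Tendsto (fun n => Literature.MathematicalPhysics.KineticTheory.RotorGas.ovyLaplace σ a₀ θ₀ u₀ T₀ (κ n) Dr (Ω / Literature.MathematicalPhysics.KineticTheory.hsDiameter σ (κ n)) (Ψ (κ n)) f) Filter.atTop (nhds (Literature.MathematicalPhysics.KineticTheory.PointProcess.laplaceFunctional μ f))) → Literature.MathematicalPhysics.KineticTheory.RotorGas.RegularStationaryState Φ μ → μ {∅} = 0 → (∀ᵐ ω ∂μ, ∀ᶠ n : ℕ in Filter.atTop, ((Literature.Analysis.FunctionSpaces.PointConfig.count ω (Literature.MathematicalPhysics.KineticTheory.PointProcess.centredBox n ×ˢ (Set.univ : Set (Literature.MathematicalPhysics.KineticTheory.V3 × D.K)))) : ENNReal) ≤ η₀ * MeasureTheory.volume (Literature.MathematicalPhysics.KineticTheory.PointProcess.centredBox (d := Fin 3) n)) → Literature.MathematicalPhysics.KineticTheory.RotorGas.IsGibbsMixture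 1 Dr μ

-- item stmt-AtomisticToContinuum-13414 · crux (kind.auto-crux: conjecture-grade) · rank 4 · open · by planner — informal only, no Lean statement yet:
--   [crux] SPECULAR REFLECTION IS AS GOOD A DIE AS AN ANOSOV ROTOR — the residual conjecture for the
--   TRUE hard-sphere gas (trivial die F ≡ id; typable once definition request D4 `OneSphereHopfProperty`
--   lands, over Literature.MathematicalPhysics.KineticTheory.IsOVYLimitState / RegularStationaryState of
--   RegularStationaryState.lean). There is η₀ > 0 such that for all σ, T₀ > 0 and continuous positive
--   profiles (a₀, u₀, θ₀): every OVY limit state μ of the torus hard-sphere gas (IsOVYLimitState σ a₀ θ₀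
--   u₀ T₀ Φ_N μ) that is a regular stationary state of an infinite hard-sphere flow Φ (diameter 1), has
--   no

/-- item stmt-AtomisticToContinuum-9235 · crux · rank 6 · open · by planner
why it might fail: One sphere carrying energy ~N costs only ~N^(2/3) entropy, so H(f_t|Gibbs)=O(N) + Liouville cannot exclude cubic tails; no N-uniform propagation-of-velocity-tails estimate exists for deterministic hard spheres at fixed density (NY2003 §2.3: 'no proof ... even in the classical case').
sources: NachtergaeleYau2003, OllaVaradhanYau1993, Varadhan1993EntropyMethods, BraxmeierEvenOlla2014, SaintRaymond2009, Literature.Barriers.AtomisticToContinuum.HighMomentumCutoffBarrierNarrow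
[crux] UNIFORM INTEGRABILITY OF THE CUBIC ENERGY CURRENT BEFORE THE FIRST SHOCK (shared typed crux
stmt-AtomisticToContinuum-3655 of route KineticWindows; the card's "cubic UI" conjunct X_T): for
continuous profiles ∃ σ₀ ∀ σ ∈ (0,σ₀) ∀ classical hs-Euler solutions on [0,T) ∀ flow families, if
the local Gibbs fields converge at t = 0 then ∀ t < T ∀ ε > 0 ∃ M ∃ N₀ ∀ N ≥ N₀ ∀ s ∈ [0,t]:
E[(N+1)⁻¹ Σ_i |v_i(s)|³ 1{|v_i(s)| > M}] ≤ ε. Needed here only for the energy equation (heat flux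
and (E+p)u): the quadratic momentum closure needs no tail input in this route (energy conservation +
the o(N) entropy bootstrap exclude sparse energy concentration, whose local-Gibbs cost is
extensive), but cubic mass on a vanishing fraction of particles has SUB-extensive cost. [difficulty:
open-problem] -/
@[route_item "route-AtomisticToContinuum-AnosovDiceHopf", crux]
def EnergyCurrentTails : Prop :=
  ∀ (a₀ θ₀ : Literature.MathematicalPhysics.KineticTheory.T3 → ℝ) (u₀ : Literature.MathematicalPhysics.KineticTheory.T3 → Literature.MathematicalPhysics.KineticTheory.V3), Continuous a₀ → Continuous θ₀ → Continuous u₀ → (∀ x, 0 < a₀ x) → (∀ x, 0 < θ₀ x) → ∃ σ₀ : ℝ, 0 < σ₀ ∧ ∀ σ : ℝ, 0 < σ → σ < σ₀ → ∀ (T : ℝ) (ρ θ : ℝ → Literature.MathematicalPhysics.KineticTheory.T3 → ℝ) (u : ℝ → Literature.MathematicalPhysics.KineticTheory.T3 → Literature.MathematicalPhysics.KineticTheory.V3), Literature.MathematicalPhysics.KineticTheory.IsHardSphereEulerSolution σ T ρ u θ → ∀ Φ : (N : ℕ) → Literature.Analysis.FluidPDE.HardSphereFlow (Literature.Analysis.FluidPDE.Torus.geometry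 (Fin 3)) (Literature.MathematicalPhysics.KineticTheory.hsDiameter σ N) (N + 1), Literature.MathematicalPhysics.KineticTheory.TendstoHydroFieldsAt (fun N => Literature.MathematicalPhysics.KineticTheory.localGibbsLaw σ a₀ u₀ θ₀ N (Φ N)) Φ ρ u θ 0 → ∀ t ∈ Set.Ico 0 T, ∀ ε : ℝ, 0 < ε → ∃ M : ℝ, ∃ N₀ : ℕ, ∀ N : ℕ, N₀ ≤ N → ∀ s ∈ Set.Icc 0 t, ∫⁻ z, ENNReal.ofReal (((N : ℝ) + 1)⁻¹ * ∑ i : Fin (N + 1), Set.indicator {v : Literature.MathematicalPhysics.KineticTheory.V3 | M < ‖v‖} (fun v => ‖v‖ ^ 3) (((Φ N).flow s z i).2)) ∂(Literature.MathematicalPhysics.KineticTheory.localGibbsLaw σ a₀ u₀ θ₀ N (Φ N)) ≤ ENNReal.ofReal ε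

/-- item stmt-AtomisticToContinuum-17604 · crux · rank 9 · open · by planner
why it might fail: UI of |v|^3 pays OVY's truncation step, not the printed bad-block/Gronwall step (cut-off error must be o(e^{-CM}): HighMomentumCutoffBarrierNarrow (c)); hard-core collisional-transfer currents are contact terms invisible to H(f_t|Gibbs)<=CN; OVY1993 is smooth-potential; step (A) sans noise unprinted
sources: OllaVaradhanYau1993, Yau1991, NachtergaeleYau2003, KipnisLandim1999, Alexander1976, Ruelle1969
[support] THE DETERMINISTIC REST OF OVY FOR HARD CORES, IN THE PACKING BAND (known method, new
setting; route-specific form of RelEntropyErgodic's RelEntropyGronwall 0780 with the ergodic input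
localised to OVY limit states; replaces OVYRemainder stmt-14286 after the 2026-08-16 statement
re-type: the conjunct's packing guard ρ_t(x)σ³ < η₀ is now a HYPOTHESIS and η₀ is the prover's
choice, at most the convergence radius of the virial/cluster expansion — exactly what step (A) and
the inverse-EOS choice of a_t need and what the unguarded 0766 silently required along imploding
Euler solutions): OVYLimitsAreGibbs → EnergyCurrentTails → RelEntropyVanishingInBand. Content: (A)
for σ < σ₀(profiles, η₀) every vague cluster point of Q^(ε_N) over the pre-shock window of a GUARDED
solution is a regular stationary state of an equilibrium infinite hard-sphere flow (Alexander1976)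
with no vacuum atom and components of density ≤ C η₀ (static large deviations for local Gibbs
references, entropy bound H(f_t | Gibbs) ≤ CN, OVY Lemma 4.1/4.2/4.7-type arguments without noise);
one-block from OVYLimitsAreGibbs; two-block / exponential LLN for canonical local Gibbs states
(cluster expansion, Ruelle1969); -/
@[route_item "route-AtomisticToContinuum-AnosovDiceHopf", crux]
def OVYRemainderInBand : Prop :=
  OVYLimitsAreGibbs → EnergyCurrentTails → RelEntropyVanishingInBand

-- item stmt-AtomisticToContinuum-13415 · support · rank 5 · open · by planner — informal only, no Lean statement yet:
--   [crux] THE MACHINE — THE ONE-SPHERE HOPF PROPERTY FORCES GIBBS (replaces the Dirichlet-form step of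
--   FritzFunakiLebowitz1994 / LiveraniOlla1996 = OllaVaradhanYau1993 §4 step (B); typable once
--   definition request D4 `OneSphereHopfProperty` lands, over RotorGas.InfiniteDicedFlow /
--   RotorGas.RegularStationaryState / RotorGas.IsGibbsMixture of InfiniteRotorGas.lean and their
--   unmarked counterparts in RegularStationaryState.lean). For EVERY rotor-die data Dr on a measurable
--   rotor space K (Literature.Analysis.FluidPDE.RotorDie — INCLUDING the trivial die F ≡ id, i.e. the
--   conjunct's gas: AnosovDie.lean d

/-- item stmt-AtomisticToContinuum-13994 · support · rank 9 · open · by planner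
why it might fail: 'Every p' is refuted (14288): a divergence-free plaque-velocity field vanishing off the disc has an interior zero. A.e.-p and a.c. law at every p still fail for degenerate dice (parallel plaque responses; one-cut-off linear Hamiltonians are rank-1 at c=0 on |p|^2=2-sqrt3); no instance in Mathlib.
sources: Liverani2004, BrinPesin1974, BurnsWilkinson2010, Dolgopyat2005, FeresZhang2012, Mityagin2015
[support] THE CONSTRUCTION, REPAIRED (supersedes DiceConstruction = stmt-AtomisticToContinuum-14288,
refuted-misstated by
Summit.AtomisticToContinuum.HydrodynamicLimit.Theorems.AnosovDiceHopfDiceConstruction_refuted: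
`IsPairPlaqueSubmersive` asks a submersion at EVERY p of the open disc, impossible for every Anosov
die since the divergence-free plaque-velocity field of r ↦ F(W θ r, θ′)∘F(θ,θ′)⁻¹ has an interior
zero; the refuted decl stays in the file as the settled negative edge): there EXISTS an Anosov die
with absolutely continuous die law that is pair-plaque submersive ALMOST EVERYWHERE (m⊗m-a.e. (θ,θ′)
and Lebesgue-a.e. p in the open disc — the refuter's C′, which the witness misses; note ∫_disc
det(Y, Z) = 0 for the two divergence-free plaque-velocity fields Y, Z, so the bad set {det = 0}
always contains a curve and "a.e. p" is the most one can ask) and SWAP-EQUIVARIANT, F(θ′,θ) =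
R′∘F(θ,θ′)∘R′ with R′ = diag(1,−1) (refuter finding F1 on stmt-14285: the condition under which the
finite-N label-ordered and the infinite `Leads`-ordered collision rules agree). Intended instance: K
= T¹M of a closed hyperbolic surface M, m = normalised Liouville, g = geodesic flow, plaques = expa -/
@[route_item "route-AtomisticToContinuum-AnosovDiceHopf"]
def DiceConstructionAE : Prop :=
  ∃ D : Literature.Dynamics.Hyperbolic.AnosovDie, D.HasAbsolutelyContinuousLaw ∧ (∀ᵐ q ∂(D.m.prod D.m), ∀ᵐ p ∂(MeasureTheory.volume.restrict (Metric.ball (0 : EuclideanSpace ℝ (Fin 2)) 1)), Function.Surjective (fderiv ℝ (D.pairPlaqueMap q.1 q.2 p) 0)) ∧ (∀ (θ θ' : D.K) (p q : EuclideanSpace ℝ (Fin 2)), q 0 = p 0 → q 1 = -(p 1) → (D.die θ' θ p) 0 = (D.die θ θ' q) 0 ∧ (D.die θ' θ p) 1 = -((D.die θ θ' q) 1))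

/-- item stmt-AtomisticToContinuum-14289 · support · rank 9 · open · by planner
sources: Alexander1975, Alexander1976, GST2013, DobrushinSinaiSukhov1989
[support] NON-VACUITY OF THE FLOW HYPOTHESES of RotorGasMacroErgodic / RotorGasEulerLimit (no
Alexander theorem for diced gases is in print, so the definitions vendor none): for every Anosov
die, (i) torus diced hard-sphere flows `DicedHardSphereFlow (Torus.geometry (Fin 3)) ε N Dr Ω` exist
for 0 < ε < 1/2, all N, Ω (Alexander1975's measure argument: the diced collision map is a smooth
flux-preserving bijection off grazing, `measurePreserving_die`, `contDiff_die`); (ii) for every Ω an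
infinite diced flow of diameter 1 that is an equilibrium flow (a.e. defined and stationary for every
Gibbs ⊗ m state) exists (Alexander1976 Thm 5.2 run for marked spheres with autonomous rotors).
[difficulty: L] -/
@[route_item "route-AtomisticToContinuum-AnosovDiceHopf"]
def DicedDynamicsExist : Prop :=
  ∀ D : Literature.Dynamics.Hyperbolic.AnosovDie, ∀ Dr : Literature.Analysis.FluidPDE.RotorDie D.K, Dr = (Literature.Analysis.FluidPDE.RotorDie.mk D.m D.flow (fun θ θ' p => D.die θ θ' p) D.rev : Literature.Analysis.FluidPDE.RotorDie D.K) → (∀ (ε Ω : ℝ) (N : ℕ), 0 < ε → ε < 2⁻¹ → Nonempty (Literature.Analysis.FluidPDE.DicedHardSphereFlow (Literature.Analysis.FluidPDE.Torus.geometry (Fin 3)) ε N Dr Ω)) ∧ (∀ Ω : ℝ, ∃ Φ : Literature.MathematicalPhysics.KineticTheory.RotorGas.InfiniteDicedFlow 1 Dr Ω, Φ.IsEquilibriumFlow)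

/-- item stmt-AtomisticToContinuum-17603 · support · rank 9 · open · by planner
sources: OllaVaradhanYau1993, Spohn1991, FritzFunakiLebowitz1994, Literature.Barriers.AtomisticToContinuum.BoltzmannHypothesisBarrierNarrow
[support] ONE-BODY LOCAL-MAXWELLIAN LAW OF LARGE NUMBERS, IN THE PACKING BAND (typed finite-N
observable content of OVY step (B); MaxwellianOneBody stmt-14290 = stmt-4742 with the conjunct's
2026-08-16 packing guard after the Euler solution and ∃ η₀ outermost — unguarded it asked
configurations to match over-packed densities ρ_t σ³ beyond close packing along imploding Euler
solutions and was refutable by statics for the wrong reason; implied by 14290 — Sketch.lean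
maxwellianOneBodyInBand_of_old): ∃ η₀ > 0 ∀ continuous profiles ∃ σ₀ ∀ σ<σ₀ ∀ classical hs-Euler
solutions on [0,T) with ρ_t(x)σ³ < η₀ ∀ flows, if the local Gibbs fields converge at t = 0 then for
every t < T, bounded continuous ψ on 𝕋³ × ℝ³ and δ > 0, P_N(|∫ψ d(empirical measure of Φ_N,t z) −
∫ρ_t(x)∫ψ(x,v) M_(1,u_t(x),θ_t(x))(v) dv dx| > δ) → 0 under the initial local Gibbs law. Necessary
for the guarded target (MaxwellianOfEntropyInBand), refutable at finite N (false for free flight),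
not implied by HydrodynamicLimit. [difficulty: open-problem] -/
@[route_item "route-AtomisticToContinuum-AnosovDiceHopf", crux]
def MaxwellianOneBodyInBand : Prop :=
  ∃ η₀ : ℝ, 0 < η₀ ∧ ∀ (a₀ θ₀ : Literature.MathematicalPhysics.KineticTheory.T3 → ℝ) (u₀ : Literature.MathematicalPhysics.KineticTheory.T3 → Literature.MathematicalPhysics.KineticTheory.V3), Continuous a₀ → Continuous θ₀ → Continuous u₀ → (∀ x, 0 < a₀ x) → (∀ x, 0 < θ₀ x) → ∃ σ₀ : ℝ, 0 < σ₀ ∧ ∀ σ : ℝ, 0 < σ → σ < σ₀ → ∀ (T : ℝ) (ρ θ : ℝ → Literature.MathematicalPhysics.KineticTheory.T3 → ℝ) (u : ℝ → Literature.MathematicalPhysics.KineticTheory.T3 → Literature.MathematicalPhysics.KineticTheory.V3), Literature.MathematicalPhysics.KineticTheory.IsHardSphereEulerSolution σ T ρ u θ → (∀ t ∈ Set.Ico 0 T, ∀ x, ρ t x * σ ^ 3 < η₀) → ∀ Φ : (N : ℕ) → Literature.Analysis.FluidPDE.HardSphereFlow (Literature.Analysis.FluidPDE.Torus.geometry (Fin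 3)) (Literature.MathematicalPhysics.KineticTheory.hsDiameter σ N) (N + 1), Literature.MathematicalPhysics.KineticTheory.TendstoHydroFieldsAt (fun N => Literature.MathematicalPhysics.KineticTheory.localGibbsLaw σ a₀ u₀ θ₀ N (Φ N)) Φ ρ u θ 0 → ∀ t ∈ Set.Ico 0 T, ∀ ψ : Literature.MathematicalPhysics.KineticTheory.T3 × Literature.MathematicalPhysics.KineticTheory.V3 → ℝ, Continuous ψ → (∃ B : ℝ, ∀ y, |ψ y| ≤ B) → ∀ δ : ℝ, 0 < δ → Filter.Tendsto (fun N : ℕ => Literature.MathematicalPhysics.KineticTheory.localGibbsLaw σ a₀ u₀ θ₀ N (Φ N) {z | δ < |∫ y, ψ y ∂(Literature.Analysis.FluidPDE.empiricalMeasure ((Φ N).flow t z)) - ∫ x, ρ t x * ∫ v, ψ (x, v) * Literature.Analysis.FluidPDE.localMaxwellian 1 (θ t x) (u t x) v|}) Filter.atTop (nhds 0)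

/-- item stmt-AtomisticToContinuum-17605 · support · rank 9 · open · by planner
sources: Yau1991, OllaVaradhanYau1993, KipnisLandim1999
[support] the one-body waypoint is NECESSARY for the guarded target — provable now, same η₀ and σ₀,
the guard a hypothesis on both sides (replaces MaxwellianOfEntropy stmt-14291): entropy inequality
μ(A) ≤ (log 2 + H(μ|λ))/log(1 + 1/λ(A)) (Literature.Probability.Entropy, KipnisLandim1999 A1.8.2,
proved in tree) plus an exponential LLN for N⁻¹Σψ(x_k,v_k) under the reference local Gibbs law
(velocities conditionally independent Maxwellians given positions: Hoeffding around N⁻¹Σg(x_k), g =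
∫ψ M dv continuous, then the density-field clause of the target with χ = g). Makes a refutation of
MaxwellianOneBodyInBand refute RelEntropyVanishingInBand — and with it the entropy routes' unguarded
shared target 0766, which implies it — mechanically. [deps: RelEntropyVanishingInBand,
MaxwellianOneBodyInBand] [difficulty: M] -/
@[route_item "route-AtomisticToContinuum-AnosovDiceHopf"]
def MaxwellianOfEntropyInBand : Prop :=
  RelEntropyVanishingInBand → MaxwellianOneBodyInBand

-- earlier RotorGasEulerLimit (stmt-AtomisticToContinuum-14023, replaced 2026-08-16T23:23:30Z -> stmt-AtomisticToContinuum-17606): retired by None — ∀ D : Literature.Dynamics.Hyperbolic.AnosovDie, D.HasAbsolutelyContinuousLaw → (∀ᵐ q ∂(D.m.prod D.m), ∀ᵐ p ∂(MeasureTheory.volume.restrict (Metric.ball (0 : EuclideanSpace ℝ (Fin 2)) 1)), Function.Surjective (fderiv ℝ (D.pairPlaqueMap q.1 q.2 p) 0)) → (∀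
-- earlier RotorGasEulerLimit (stmt-AtomisticToContinuum-14287, replaced 2026-08-15T20:54:17Z -> stmt-AtomisticToContinuum-13993): retired by None — ∀ D : Literature.Dynamics.Hyperbolic.AnosovDie, D.HasAbsolutelyContinuousLaw → D.IsPairPlaqueSubmersive → ∀ Dr : Literature.Analysis.FluidPDE.RotorDie D.K, Dr = (Literature.Analysis.FluidPDE.RotorDie.mk D.m D.flow (fun θ θ' p => D.die θ θ' p) D.rev : Lit
/-- item stmt-AtomisticToContinuum-17606 · support · rank 9 · open · by planner
sources: OllaVaradhanYau1993, Yau1991, FritzFunakiLebowitz1994, CanestrariLiveraniOlla2026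
[support] THE ANALOGUE THEOREM, PACKING-GUARDED LIKE THE CONJUNCT (card crux 2; 2026-08-16 restate
of stmt-14023 after the statement re-type p126922: `∃ η₀ > 0` after the die hypotheses and the guard
`∀ t ∈ Ico 0 T, ∀ x, ρ t x * σ ^ 3 < η₀` after the Euler solution, everything else verbatim; the old
14023 implies it — Sketch.lean rotorGasEulerLimitGuarded_of_old — and, like the old conjunct,
covered imploding Euler solutions that no hard-core gas can follow beyond close packing): for every
Anosov die of the repaired class (a.c. die law, a.e. pair-plaque submersive, swap-equivariant) there
is η₀ > 0 such that for all continuous positive profiles there is Ω₀ such that for Ω ≥ Ω₀ there is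
σ₀ with, for σ < σ₀, every classical hs-Euler solution on [0,T) with ρ_t(x)σ³ < η₀ (the SAME
IsHardSphereEulerSolution: the die changes no statics) and every family Ψ_N of torus diced flows
HS_rot(Ω/ε_N, D): if under the local Gibbs ⊗ m^⊗ laws the empirical density / momentum / energy
fields of the translational configuration converge in probability at t = 0, they converge for every
t < T — if completed, the first deterministic, time-reversible, Liouville ⊗ m-preserving,
fixed-positive-density compre -/
@[route_item "route-AtomisticToContinuum-AnosovDiceHopf"]
def RotorGasEulerLimit : Prop :=
  ∀ D : Literature.Dynamics.Hyperbolic.AnosovDie, D.HasAbsolutelyContinuousLaw → (∀ᵐ q ∂(D.m.prod D.m), ∀ᵐ p ∂(MeasureTheory.volume.restrict (Metric.ball (0 : EuclideanSpace ℝ (Fin 2)) 1)), Function.Surjective (fderiv ℝ (D.pairPlaqueMap q.1 q.2 p) 0)) → (∀ (θ θ' : D.K) (p q : EuclideanSpace ℝ (Fin 2)), q 0 = p 0 → q 1 = -(p 1) → (D.die θ' θ p) 0 = (D.die θ θ' q) 0 ∧ (D.die θ' θ p) 1 = -((D.die θ θ' q) 1)) → ∀ Dr : Literature.Analysis.FluidPDE.RotorDie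 D.K, Dr = (Literature.Analysis.FluidPDE.RotorDie.mk D.m D.flow (fun θ θ' p => D.die θ θ' p) D.rev : Literature.Analysis.FluidPDE.RotorDie D.K) → ∃ η₀ : ℝ, 0 < η₀ ∧ ∀ (a₀ θ₀ : Literature.MathematicalPhysics.KineticTheory.T3 → ℝ) (u₀ : Literature.MathematicalPhysics.KineticTheory.T3 → Literature.MathematicalPhysics.KineticTheory.V3), Continuous a₀ → Continuous θ₀ → Continuous u₀ → (∀ x, 0 < a₀ x) → (∀ x, 0 < θ₀ x) → ∃ Ω₀ : ℝ, ∀ Ω : ℝ, Ω₀ ≤ Ω → ∃ σ₀ : ℝ, 0 < σ₀ ∧ ∀ σ : ℝ, 0 < σ → σ < σ₀ → ∀ (T : ℝ) (ρ θ : ℝ → Literature.MathematicalPhysics.KineticTheory.T3 → ℝ) (u : ℝ → Literature.MathematicalPhysics.KineticTheory.T3 → Literature.MathematicalPhysics.KineticTheory.V3), Literature.MathematicalPhysics.KineticTheory.IsHardSphereEulerSolution σ T ρ u θ → (∀ t ∈ Set.Ico 0 T, ∀ x, ρ t x * σ ^ 3 < η₀) → ∀ Ψ : (N : ℕ) → Literature.Analysis.FluidPDE.DicedHardSphereFlow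 (Literature.Analysis.FluidPDE.Torus.geometry (Fin 3)) (Literature.MathematicalPhysics.KineticTheory.hsDiameter σ N) (N + 1) Dr (Ω / Literature.MathematicalPhysics.KineticTheory.hsDiameter σ N), (∀ χ : Literature.MathematicalPhysics.KineticTheory.T3 → ℝ, Continuous χ → ∀ δ : ℝ, 0 < δ → Filter.Tendsto (fun N : ℕ => Literature.MathematicalPhysics.KineticTheory.RotorGas.rotorLocalGibbsLaw σ a₀ u₀ θ₀ N Dr {z | δ < |Literature.MathematicalPhysics.KineticTheory.empiricalDensityField ((Ψ N).configFlow 0 z) χ - ∫ x, χ x * ρ 0 x|}) Filter.atTop (nhds 0) ∧ Filter.Tendsto (fun N : ℕ => Literature.MathematicalPhysics.KineticTheory.RotorGas.rotorLocalGibbsLaw σ a₀ u₀ θ₀ N Dr {z | δ < ‖Literature.MathematicalPhysics.KineticTheory.empiricalMomentumField ((Ψ N).configFlow 0 z) χ - ∫ x, (χ x * ρ 0 x) • u 0 x‖}) Filter.atTop (nhds 0) ∧ Filter.Tendsto (fun N : ℕ => Literature.MathematicalPhysics.KineticTheory.RotorGas.rotorLocalGibbsLaw σ a₀ u₀ θ₀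 N Dr {z | δ < |Literature.MathematicalPhysics.KineticTheory.empiricalEnergyField ((Ψ N).configFlow 0 z) χ - ∫ x, χ x * Literature.MathematicalPhysics.KineticTheory.totalEnergyDensity (ρ 0 x) (u 0 x) (θ 0 x)|}) Filter.atTop (nhds 0)) → ∀ t ∈ Set.Ico 0 T, (∀ χ : Literature.MathematicalPhysics.KineticTheory.T3 → ℝ, Continuous χ → ∀ δ : ℝ, 0 < δ → Filter.Tendsto (fun N : ℕ => Literature.MathematicalPhysics.KineticTheory.RotorGas.rotorLocalGibbsLaw σ a₀ u₀ θ₀ N Dr {z | δ < |Literature.MathematicalPhysics.KineticTheory.empiricalDensityField ((Ψ N).configFlow t z) χ - ∫ x, χ x * ρ t x|}) Filter.atTop (nhds 0) ∧ Filter.Tendsto (fun N : ℕ => Literature.MathematicalPhysics.KineticTheory.RotorGas.rotorLocalGibbsLaw σ a₀ u₀ θ₀ N Dr {z | δ < ‖Literature.MathematicalPhysics.KineticTheory.empiricalMomentumField ((Ψ N).configFlow t z) χ - ∫ x, (χ x * ρ t x) • u t x‖}) Filter.atTop (nhds 0) ∧ Filter.Tendsto (fun N : ℕ => Literature.MathematicalPhysics.KineticTheory.RotorGas.rotorLocalGibbsLaw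 σ a₀ u₀ θ₀ N Dr {z | δ < |Literature.MathematicalPhysics.KineticTheory.empiricalEnergyField ((Ψ N).configFlow t z) χ - ∫ x, χ x * Literature.MathematicalPhysics.KineticTheory.totalEnergyDensity (ρ t x) (u t x) (θ t x)|}) Filter.atTop (nhds 0))

/-- item stmt-AtomisticToContinuum-17397 · assembly · rank 1 · open · by planner
sources: KipnisLandim1999, OllaVaradhanYau1993
[support] GUARDED ENTROPY DOCK (packing-guarded twin of the closed glue item
stmt-AtomisticToContinuum-0769 EntropyToFields): RelEntropyVanishingInBand → the re-typed conjunct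
`_root_.HydrodynamicLimit`. Proof (8 lines, checked rc 0 in the planner's Sketch.lean, attached as
evidence): take η₀ and σ₀ from the hypothesis; for σ < σ₀, a guarded classical solution, Φ,
convergence at t = 0 and t < T, obtain ⟨a_t, probability, concentration, klDiv → 0⟩ and apply the
tree lemma Summit.AtomisticToContinuum.HydrodynamicLimit.Theorems.tendstoHydroFieldsAt_of_klDiv
(Theorems/TwoClocksEntropyToHydro.lean: entropy inequality for events μ(A)·L ≤ KL(μ‖ν) + (e^L −
1)ν(A), exponential concentration of the reference, transfer along the measurable flow). Becomes the
last hypothesis of `closes` (replacing EntropyToFields + HydrodynamicLimit.of_unguarded) once crux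
#4 is restated to conclude RelEntropyVanishingInBand. [deps: RelEntropyVanishingInBand] [difficulty:
S] -/
@[route_item "route-AtomisticToContinuum-AnosovDiceHopf"]
def EntropyMethodTransferInBand : Prop :=
  RelEntropyVanishingInBand → _root_.HydrodynamicLimit

-- records of items no longer active in this route (dropped / restated):
-- earlier RelEntropyVanishing (stmt-AtomisticToContinuum-0766, replaced 2026-08-16T23:23:30Z -> stmt-AtomisticToContinuum-17396): open — ∀ (a₀ θ₀ : Literature.MathematicalPhysics.KineticTheory.T3 → ℝ) (u₀ : Literature.MathematicalPhysics.KineticTheory.T3 → Literature.MathematicalPhysics.KineticTheory.V3), Continuous a₀ → Continuous θ₀ → Continuous u₀ → (∀ x, 0 < a₀ x) → (∀ x, 0 < θ₀ x) → ∃ σ₀ : ℝ, 0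
-- earlier OVYRemainder (stmt-AtomisticToContinuum-14286, replaced 2026-08-16T23:23:30Z -> stmt-AtomisticToContinuum-17604): retired by None — OVYLimitsAreGibbs → EnergyCurrentTails → RelEntropyVanishing
-- earlier DiceConstruction (stmt-AtomisticToContinuum-14288, replaced 2026-08-15T20:54:43Z -> stmt-AtomisticToContinuum-13994): refuted by Summit.AtomisticToContinuum.HydrodynamicLimit.Theorems.AnosovDiceHopfDiceConstruction_refuted @ 929916b56451 — ∃ D : Literature.Dynamics.Hyperbolic.AnosovDie, D.HasAbsolutelyContinuousLaw ∧ D.IsPairPlaqueSubmersive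
-- earlier MaxwellianOneBody (stmt-AtomisticToContinuum-14290, replaced 2026-08-16T23:23:30Z -> stmt-AtomisticToContinuum-17603): retired by None — ∀ (a₀ θ₀ : Literature.MathematicalPhysics.KineticTheory.T3 → ℝ) (u₀ : Literature.MathematicalPhysics.KineticTheory.T3 → Literature.MathematicalPhysics.KineticTheory.V3), Continuous a₀ → Continuous θ₀ → Continuous u₀ → (∀ x, 0 < a₀ x) → (∀ x, 0 < θ₀ x) → ∃
-- earlier MaxwellianOfEntropy (stmt-AtomisticToContinuum-14291, replaced 2026-08-16T23:23:30Z -> stmt-AtomisticToContinuum-17605): retired by None — RelEntropyVanishing → MaxwellianOneBody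
-- earlier EntropyMethodTransfer (stmt-AtomisticToContinuum-9240, replaced 2026-08-16T23:23:30Z -> stmt-AtomisticToContinuum-17397): proved by Summit.AtomisticToContinuum.HydrodynamicLimit.Theorems.hydrodynamicLimit_of_relEntropyVanishing — RelEntropyVanishing → _root_.HydrodynamicLimit

/-! D-0027 §2.1 — DECIDING THEOREM (planner-authored via `route open/edit --closes-file`; by planner-rbadge-AtomisticToContinuum-AnosovDice-ca529dbc-0 2026-08-16T23:43:36Z):
its hypotheses are this route's items and its conclusion the sub-problem Statement (glue_lint), and it elaborates with this file. -/

@[closes "route-AtomisticToContinuum-AnosovDiceHopf"] theorem closes (h₂ : OVYLimitsAreGibbs) (h₆ : EnergyCurrentTails) (h₈ : OVYRemainderInBand) :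
    _root_.HydrodynamicLimit := by
  -- crux-only (route-repair 2026-08-16): the three binders are the typed CRUX items of the spine;
  -- the former assembly item EntropyMethodTransferInBand is no longer assumed but proved here.
  -- The GUARDED Yau target RelEntropyVanishingInBand is PRODUCED by the in-band OVY remainder (h₈)
  -- from the one-block input X_G (h₂) and the cubic tails X_T (h₆) …
  obtain ⟨η₀, hη₀, H⟩ := h₈ h₂ h₆
  -- … and the packing-guarded conjunct follows with the SAME η₀ and σ₀: the guard is threaded
  -- through unchanged and the landed entropy-inequality step is applied at each t < T.
  refine ⟨η₀, hη₀, fun a₀ θ₀ u₀ ha hθ hu ha0 hθ0 => ?_⟩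
  obtain ⟨σ₀, hσ₀, G⟩ := H a₀ θ₀ u₀ ha hθ hu ha0 hθ0
  refine ⟨σ₀, hσ₀, fun σ hσ hσ' T ρ θ u hsol hguard Φ h0 t ht => ?_⟩
  obtain ⟨hprob, hmain⟩ := G σ hσ hσ' T ρ θ u hsol hguard Φ
  obtain ⟨a, hψ, hconc, hkl⟩ := hmain h0 t ht
  exact Summit.AtomisticToContinuum.HydrodynamicLimit.Theorems.tendstoHydroFieldsAt_of_klDiv
    (a := a) Φ hconc hkl

end Summit.AtomisticToContinuum.HydrodynamicLimit.Theses.AnosovDiceHopf
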